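import Literature.AlgebraicGeometry.AbelianSchemes.AbelianSchemeConstSubgroupQuotient
import HarnessLib

/-!
# `K`-stable affine opens pull back along an affine homomorphism of abelian schemes (`hcov` transfer)

Topic `AlgebraicGeometry/AbelianSchemes`; namespace `Literature.AlgebraicGeometry.AbelianSchemes.AbelianSchemeOver`; a *proofs*
file (theorems only). For abelian schemes `A, B` over `S`, a morphism `u : S → Y` to an AFFINE `Y`, and an `S`-HOMOMORPHISM
`μ : B → A` which is an AFFINE morphism of schemes (e.g. finite: an isogeny, a quasi-inverse `μ` of a polarisation with
`λ ≫ μ = [e]`), the hypothesis `hcov` of the tree's quotient-by-a-finite-group-of-sections files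
(★ `AbelianSchemeOver.quotientBy … (hcov : ∀ x, ∃ O : (A.translationActionOver u K).StableAffineOpens, x ∈ O.1)`,
Mumford, *Abelian Varieties* §7 Thm. p. 66 «(†) every orbit lies in an affine open») TRANSFERS from `A` to `B`:

* `translation_comp_hom` — `t_{σ′} ≫ φ = φ ≫ t_{σ′ ≫ μ}`: a homomorphism intertwines the translation by a section `σ′` of `B`
  with the translation by its image section of `A` (Görtz–Wedhorn II, Def./Rem. 27.1);
* **`translationActionOver_hcov_of_hom`** — if every point of `A` lies in a `K`-stable open affine over `Y` for EVERY finite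
  subgroup `K ⊆ A(S)`, then every point of `B` lies in a `K′`-stable open affine over `Y` for every finite `K′ ⊆ B(S)`: take
  `K := μ_* K′` and the preimages `μ⁻¹O` (stable by `translation_comp_hom`, affine over `Y` because `μ∣_O` is affine).

Cell `hodgecm-mathlib`, socket-(B) chain, brick (B5) «`hcov′` for the dual family `Â′`» (road E: along the quasi-inverse
`μ : Â′ → A′` of ★ `Polarization.exists_quasiInverse_of_charZero`, no quasi-projectivity of `Â′` needed); B-p10 (g10).
Everything is proved; no named facts; no definitions. Mathlib searched and used (pin): `IsMonHom.monoidHom`, `MonObj.mul_comp`,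
`MonObj.comp_mul`, `CartesianMonoidalCategory.comp_toUnit`, `Subgroup.map`, `morphismRestrict_ι`, `Scheme.Hom.comp_preimage`.

## References

* D. Mumford, *Abelian Varieties* (2nd ed. 1974), §7, Theorem p. 66 and Thm. 4 (p. 72). [MumfordAV1970]
* U. Görtz, T. Wedhorn, *Algebraic Geometry II* (2023), Def./Rem. 27.1 (p. 604). [GortzWedhorn2023]
* A. Grothendieck, *SGA 1*, Exp. V, Prop. 1.8. [SGA1]
-/

noncomputable section

universe u

open CategoryTheory CategoryTheory.Limits AlgebraicGeometry MonoidalCategory CartesianMonoidalCategory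
open scoped MonObj

namespace Literature.AlgebraicGeometry.AbelianSchemes

namespace AbelianSchemeOver

open Literature.AlgebraicGeometry.RelativeSpec

variable {S : Scheme.{u}} (A B : AbelianSchemeOver S) (φ : B.X ⟶ A.X) [IsMonHom φ]

/-- **A homomorphism intertwines translations**: `t_{σ′} ≫ φ = φ ≫ t_{σ′ ≫ μ}` for a section `σ′` of `B` and an
`S`-homomorphism `μ : B → A` (`μ(x + σ′) = μ(x) + μ(σ′)` on points). [cite: GortzWedhorn2023, Def./Rem. 27.1 (p. 604)] -/
theorem translation_comp_hom (σ' : B.Sections) : B.translation σ' ≫ φ = φ ≫ A.translation (σ' ≫ φ) := by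
  unfold translation
  rw [MonObj.mul_comp, Category.id_comp, MonObj.comp_mul, Category.comp_id, Category.assoc, comp_toUnit_assoc]

/-- On underlying schemes: `(t_{σ′})₀ ≫ μ₀ = μ₀ ≫ (t_{σ′ ≫ μ})₀`. [cite: GortzWedhorn2023, Def./Rem. 27.1 (p. 604)] -/
theorem translation_left_comp_hom_left (σ' : B.Sections) :
    (B.translation σ').left ≫ φ.left = φ.left ≫ (A.translation (σ' ≫ φ)).left := by
  rw [← Over.comp_left, translation_comp_hom, Over.comp_left]

variable {Y : Scheme.{u}} (u : S ⟶ Y)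

/-- **Preimages of stable opens are stable**: for `K′ ⊆ B(S)` and a `μ_*K′`-stable open `O ⊆ A`, `μ⁻¹O` is `K′`-stable.
[cite: MumfordAV1970, §7 Thm. 4 (p. 72)] -/
theorem preimage_translation_preimage_eq_of_stable (K' : Subgroup B.Sections) (O : A.left.Opens)
    (hO : ∀ τ : A.Sections, τ ∈ K'.map (IsMonHom.monoidHom φ (𝟙_ (Over S))) → (A.translation τ).left ⁻¹ᵁ O = O)
    (σ' : K') :
    (B.translation (σ' : B.Sections)).left ⁻¹ᵁ (φ.left ⁻¹ᵁ O) = φ.left ⁻¹ᵁ O := by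
  have hmem : (σ' : B.Sections) ≫ φ ∈ K'.map (IsMonHom.monoidHom φ (𝟙_ (Over S))) :=
    Subgroup.mem_map_of_mem _ σ'.2
  rw [← Scheme.Hom.comp_preimage, translation_left_comp_hom_left, Scheme.Hom.comp_preimage, hO _ hmem]

/-- **`hcov` transfers along an affine homomorphism** (road E of the cell's (B5)): let `μ : B → A` be an `S`-homomorphism
of abelian schemes which is an AFFINE morphism, `u : S → Y` with `Y` affine. If for every finite subgroup `K ⊆ A(S)` every
point of `A` lies in a `K`-stable open which is affine over `Y`, then for every finite `K′ ⊆ B(S)` every point of `B` lies in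
a `K′`-stable open affine over `Y` — namely `μ⁻¹O` for `O` a `μ_*K′`-stable affine open through `μ(x)` (Mumford §7 Thm. p. 66
(†) for the translation action of `K′`, obtained from (†) for `μ_*K′` on `A`). [cite: MumfordAV1970, §7 Thm. p. 66 (hypothesis)]
[cite: SGA1, Exp. V, Prop. 1.8] -/
theorem translationActionOver_hcov_of_hom [IsAffineHom φ.left] (K' : Subgroup B.Sections)
    (hA : ∀ (K : Subgroup A.Sections) [Finite K] (x : A.left), ∃ O : (A.translationActionOver u K).StableAffineOpens, x ∈ O.1)
    [Finite K'] :
    ∀ x : B.left, ∃ O : (B.translationActionOver u K').StableAffineOpens, x ∈ O.1 := by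
  intro x
  set K : Subgroup A.Sections := K'.map (IsMonHom.monoidHom φ (𝟙_ (Over S))) with hK
  haveI : Finite K := by
    refine Finite.of_surjective (fun σ' : K' => (⟨(σ' : B.Sections) ≫ φ, Subgroup.mem_map_of_mem _ σ'.2⟩ : K)) ?_
    rintro ⟨y, hy⟩
    obtain ⟨σ, hσ, rfl⟩ := Subgroup.mem_map.mp hy
    exact ⟨⟨σ, hσ⟩, rfl⟩
  obtain ⟨O, hxO⟩ := hA K (φ.left x)
  refine ⟨⟨φ.left ⁻¹ᵁ O.1, fun σ' => ?_, ?_⟩, hxO⟩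
  · -- stability
    rw [translationActionOver_aut_hom]
    exact preimage_translation_preimage_eq_of_stable A B φ K' O.1 (fun τ hτ => O.2.1 ⟨τ, hτ⟩) σ'
  · -- affine over `Y`: `(μ⁻¹O).ι ≫ B → Y = (μ∣_O) ≫ O.ι ≫ A → Y`
    have hfac : (φ.left ⁻¹ᵁ O.1).ι ≫ B.X.hom ≫ u = (φ.left ∣_ O.1) ≫ O.1.ι ≫ A.X.hom ≫ u := by
      rw [← Category.assoc (φ.left ∣_ O.1), morphismRestrict_ι, Category.assoc, ← Category.assoc φ.left, Over.w φ]
    rw [hfac]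
    have h2 : IsAffineHom (O.1.ι ≫ A.X.hom ≫ u) := O.2.2
    have h1 : IsAffineHom (φ.left ∣_ O.1) :=
      MorphismProperty.of_isPullback (P := @IsAffineHom) (isPullback_morphismRestrict φ.left O.1).flip inferInstance
    exact MorphismProperty.comp_mem _ _ _ h1 h2

end AbelianSchemeOver

end Literature.AlgebraicGeometry.AbelianSchemes

end
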